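import Literature.Computability.Complexity.CodeFPBudgets
import Mathlib.NumberTheory.Padics.PadicVal.Basic
import HarnessLib

/-!
# Stub `stub_twoAdicSplitCodeFP` (line `Sketch`, crux `MobiusLadder.LiouvilleNotPPoly`)

The `2`-adic split `N ↦ (N / 2^{v₂(N)}, v₂(N) mod 2)` (odd part, parity of the `2`-adic
valuation; `0 ↦ (0, false)`) is computed on codes by a polynomial-time string function, in the
typed algebra `CodeFP` (`CodeFP.lean`, `CodeFPArith.lean`, `CodeFPBudgets.lean`). The machine is
the halving scan: state `(M, b) : ℕ × Bool`, initially `(N, false)`; a round replaces `(M, b)` by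
`(M / 2, ¬b)` while `M` is even and nonzero and freezes otherwise, so that after `i` rounds the
state is `(N / 2^r, bodd r)` with `r = min i (v₂ N)` (`step_state`, `foldl_step_state`); a unit
budget of `size N ≥ v₂(N)` rounds (`replicateUnit ∘ strLength ∘ strOfNat`) therefore ends at
the split. The loop is `CodeFP.foldl`, whose accumulator bound is `M ≤ N ⇒ |bin M| ≤ |bin N|`.
Template: `CodeFP.natLog2Min` (`CodeFPBudgets.lean`). Theorems only (no definitions: the step
and the state are written as explicit lambdas / pairs).

## References

* S. Arora, B. Barak, *Computational Complexity: A Modern Approach*, CUP 2009, §1.3 (closure of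
  polynomial time under composition and polynomially bounded loops).
-/

set_option linter.dupNamespace false -- D-0017: single-problem summit, by design

namespace Summit.QuantumAdvantage.QuantumAdvantage.Theorems.LiouvilleNotPPoly

namespace TwoAdicSplit

open _root_.Computability Polynomial Literature.Computability.Complexity
  Literature.Computability.Complexity.CodeFP

/-! ### The halving scan, mathematically -/

/-- One round of the halving scan (halve an even nonzero first component and flip the parity
bit; freeze otherwise) advances the state `(N / 2^r, bodd r)`, `r = min i (v₂ N)`, from round
`i` to round `i + 1`. [folklore] -/
theorem step_state (N i : ℕ) :
    (if N / 2 ^ min i (padicValNat 2 N) % 2 = 0 ∧ N / 2 ^ min i (padicValNat 2 N) ≠ 0 then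
        (N / 2 ^ min i (padicValNat 2 N) / 2, !Nat.bodd (min i (padicValNat 2 N)))
      else (N / 2 ^ min i (padicValNat 2 N), Nat.bodd (min i (padicValNat 2 N)))) =
      (N / 2 ^ min (i + 1) (padicValNat 2 N), Nat.bodd (min (i + 1) (padicValNat 2 N))) := by
  by_cases hi : i + 1 ≤ padicValNat 2 N
  · have hN : N ≠ 0 := by
      rintro rfl
      simp at hi
    have hdvd : 2 ^ (i + 1) ∣ N := (padicValNat_dvd_iff_le hN).2 hi
    rw [min_eq_left (by omega : i ≤ padicValNat 2 N), min_eq_left hi]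
    obtain ⟨k, hk⟩ := hdvd
    have h1 : N / 2 ^ i = 2 * k := by
      rw [hk, pow_succ, mul_assoc, Nat.mul_div_cancel_left _ (Nat.two_pow_pos i)]
    have h2 : N / 2 ^ (i + 1) = k := by
      rw [hk, Nat.mul_div_cancel_left _ (Nat.two_pow_pos (i + 1))]
    have hk0 : k ≠ 0 := by
      rintro rfl
      rw [mul_zero] at hk
      exact hN hk
    rw [if_pos ⟨by rw [h1]; omega, by rw [h1]; omega⟩, h1, h2, Nat.bodd_succ]
    congr 1
    omega
  · have hv : padicValNat 2 N ≤ i := by omega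
    rw [min_eq_right hv, min_eq_right (by omega : padicValNat 2 N ≤ i + 1), if_neg]
    rintro ⟨he, hne⟩
    rcases eq_or_ne N 0 with rfl | hN
    · exact hne (Nat.zero_div _)
    · have h0 : padicValNat 2 (N / 2 ^ padicValNat 2 N) = 0 := by
        rw [padicValNat.div_pow pow_padicValNat_dvd, Nat.sub_self]
      exact (dvd_iff_padicValNat_ne_zero hne).1 (Nat.dvd_of_mod_eq_zero he) h0

/-- The halving scan run from round `i` over `|l|` further rounds ends in the state of round
`i + |l|`. [folklore] -/
theorem foldl_step_state (N : ℕ) (l : List Unit) : ∀ i : ℕ,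
    l.foldl (fun (st : ℕ × Bool) (_ : Unit) =>
        if st.1 % 2 = 0 ∧ st.1 ≠ 0 then (st.1 / 2, !st.2) else st)
      (N / 2 ^ min i (padicValNat 2 N), Nat.bodd (min i (padicValNat 2 N))) =
    (N / 2 ^ min (i + l.length) (padicValNat 2 N),
      Nat.bodd (min (i + l.length) (padicValNat 2 N))) := by
  induction l with
  | nil => intro i; simp
  | cons a l ih =>
    intro i
    rw [List.foldl_cons, List.length_cons]
    dsimp only
    rw [step_state, ih (i + 1), show i + 1 + l.length = i + (l.length + 1) by omega]

/-- `v₂(N) ≤ size N` (`2^{v₂ N} ≤ N < 2^{size N}` for `N ≠ 0`). [folklore] -/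
theorem padicValNat_two_le_size (N : ℕ) : padicValNat 2 N ≤ Nat.size N := by
  rcases eq_or_ne N 0 with rfl | hN
  · simp
  · exact (Nat.lt_size.2 (Nat.le_of_dvd (Nat.pos_of_ne_zero hN) pow_padicValNat_dvd)).le

/-! ### The halving scan on codes -/

/-- The round of the halving scan is computed on codes (record: context `N`, a unit item, the
state). [cite: AroraBarak2009, §1.3] -/
theorem step_codeFP :
    CodeFP (pairE natE (pairE unitE (pairE natE bitE))) (pairE natE bitE)
      (fun t : ℕ × (Unit × (ℕ × Bool)) =>
        if t.2.2.1 % 2 = 0 ∧ t.2.2.1 ≠ 0 then (t.2.2.1 / 2, !t.2.2.2) else t.2.2) := by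
  have hM : CodeFP (pairE natE (pairE unitE (pairE natE bitE))) natE
      (fun t : ℕ × (Unit × (ℕ × Bool)) => t.2.2.1) := (snd _ _).snd'.fst'
  have hB : CodeFP (pairE natE (pairE unitE (pairE natE bitE))) bitE
      (fun t : ℕ × (Unit × (ℕ × Bool)) => t.2.2.2) := (snd _ _).snd'.snd'
  have hEven : CodeFP (pairE natE (pairE unitE (pairE natE bitE))) bitE
      (fun t : ℕ × (Unit × (ℕ × Bool)) => decide (t.2.2.1 % 2 = 0)) :=
    natEq.comp ((natMod.comp (hM.pair (const _ 2))).pair (const _ 0))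
  have hNZ : CodeFP (pairE natE (pairE unitE (pairE natE bitE))) bitE
      (fun t : ℕ × (Unit × (ℕ × Bool)) => !decide (t.2.2.1 = 0)) :=
    (natEq.comp (hM.pair (const _ 0))).not
  have hT : CodeFP (pairE natE (pairE unitE (pairE natE bitE))) (pairE natE bitE)
      (fun t : ℕ × (Unit × (ℕ × Bool)) => (t.2.2.1 / 2, !t.2.2.2)) :=
    (natDiv.comp (hM.pair (const _ 2))).pair hB.not
  exact ((hEven.and hNZ).ite hT (snd _ _).snd').congr fun t => by
    simp only [Bool.and_eq_true, Bool.not_eq_true', decide_eq_true_eq, decide_eq_false_iff_not,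
      ne_eq]

/-- **The halving scan as a bounded loop**: `(N, l) ↦ (N / 2^r, bodd r)`, `r = min |l| (v₂ N)`.
[cite: AroraBarak2009, §1.3 (polynomially bounded loops)] -/
theorem scan_codeFP :
    CodeFP (pairE natE (rawE unitE)) (pairE natE bitE)
      (fun p : ℕ × List Unit => (p.1 / 2 ^ min p.2.length (padicValNat 2 p.1),
        Nat.bodd (min p.2.length (padicValNat 2 p.1)))) := by
  have hinit : CodeFP natE (pairE natE bitE)
      (fun N : ℕ => (N / 2 ^ min 0 (padicValNat 2 N), Nat.bodd (min 0 (padicValNat 2 N)))) :=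
    ((CodeFP.id natE).pair (const natE false)).congr fun N => by simp
  have h := foldl
    (step := fun (_ : ℕ) (_ : Unit) (st : ℕ × Bool) =>
      if st.1 % 2 = 0 ∧ st.1 ≠ 0 then (st.1 / 2, !st.2) else st)
    (init := fun N : ℕ => (N / 2 ^ min 0 (padicValNat 2 N), Nat.bodd (min 0 (padicValNat 2 N))))
    step_codeFP hinit (X + 1) (fun N l₁ l₂ => by
      rw [foldl_step_state, Nat.zero_add]
      simp only [pairE_apply, length_boolPair, eval_add, eval_X, eval_one, bitE,
        List.length_cons, List.length_nil]
      have h1 : (natE (N / 2 ^ min l₁.length (padicValNat 2 N))).length ≤ (natE N).length := by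
        rw [length_natE, length_natE]
        exact size_mono (Nat.div_le_self _ _)
      omega)
  exact h.congr fun p => by rw [foldl_step_state, Nat.zero_add]

/-- The budget of the scan: `N ↦` `size N` unit items (`size N = |bin N|`). [folklore] -/
theorem budget_codeFP : CodeFP natE (rawE unitE) (fun N => List.replicate (Nat.size N) ()) :=
  (replicateUnit.comp (strLength.comp strOfNat)).congr fun N => by
    simp [length_natE]

end TwoAdicSplit

open Literature.Computability.Complexity Literature.Computability.Complexity.CodeFP

/-- **STUB T1b · `stub_twoAdicSplitCodeFP`**: `N ↦ (N / 2^{v₂(N)}, v₂(N) mod 2)` (odd part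
and parity of the `2`-adic valuation; `0 ↦ (0, false)`) is computed on codes in polynomial
time — the halving scan `TwoAdicSplit.scan_codeFP` run over a budget of `size N ≥ v₂(N)` unit
items.
[cite: AroraBarak2009, §1.3] -/
theorem stub_twoAdicSplitCodeFP :
    Literature.Computability.Complexity.CodeFP Literature.Computability.Complexity.CodeFP.natE
      (Literature.Computability.Complexity.CodeFP.pairE
        Literature.Computability.Complexity.CodeFP.natE
        Literature.Computability.Complexity.CodeFP.bitE)
      (fun N : ℕ => (N / 2 ^ padicValNat 2 N, Nat.bodd (padicValNat 2 N))) := by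
  refine (TwoAdicSplit.scan_codeFP.comp
    ((CodeFP.id natE).pair TwoAdicSplit.budget_codeFP)).congr fun N => ?_
  dsimp only [id_eq]
  rw [List.length_replicate, min_eq_right (TwoAdicSplit.padicValNat_two_le_size N)]

end Summit.QuantumAdvantage.QuantumAdvantage.Theorems.LiouvilleNotPPoly
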